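import Literature.AnabelianGeometry.SemiGraphs.TemperedReconstructionBaseUniquenessProofs
import Literature.AnabelianGeometry.SemiGraphs.SemiGraphCuspOmission
import HarnessLib

/-!
# [SemiAnbd] Cor. 3.9 (b) uniqueness / Cor. 3.11 "extends uniquely": the underlying morphism of
# semi-graphs of a chart-compatible morphism is unique — for SEMI-GRAPHS of anabelioids WITH CUSPS
# (proof-only)

Mochizuki, *Semi-graphs of anabelioids*, Publ. RIMS **42** (2006), §3, Cor. 3.9 p. 43 ("manifestly
unique") and Cor. 3.11, proof, pp. 46–47 ("the natural, functorial isomorphism of graphs of anabelioids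
`G[α]_Σ ⥲ G[β]_Σ` induced by `γ` extends uniquely to … `G^c[α]_Σ ⥲ G^c[β]_Σ`"; (ii) "the decomposition
groups of cusps … are commensurably terminal") [cite: MochizukiSemiAnbd2006, Cor 3.11 pp.46-47].

PROOF-ONLY file (abc-iut cell, layer L3, sub-DAG SemiAnbd-Cor311 sub-node C, seat abc-iut-w4-d083;
L3-lead ruling α89).  The Cor. 3.9 (b) uniqueness theorems of `TemperedReconstructionReductions.lean`
(`compatible_vertexMap_eq`, abc-iut-L3-t2) and `TemperedReconstructionBaseUniquenessProofs.lean`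
(`exists_map_branchSubgroup_le_of_compat`, `relIndex_map_range_ne_zero_of_compat`,
`compatible_branchMap_eq`, abc-iut-w4-d083) bind `Cor39Hypotheses` (GRAPHS of anabelioids) but use it
only through `.thm37Hypotheses` / `.isOfInjectiveType` and, for the branch map, through "every branch
abuts".  Here the SAME proofs are run under `Thm37Hypotheses` for the branches that abut — so they
apply to the semi-graph of anabelioids `G^c` WITH CUSPS of a pointed stable curve (Ex. 3.10), where
every edge (node or cusp) has an abutting branch:

* `vertexMap_eq_of_compatV_thm37` — two locally open `F, F'` compatible with the same `φ` on verticial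
  homomorphisms have the same vertex map (Thm. 3.7 (i), (ii));
* `branchMap_eq_of_compatV_thm37` — … and the same image of every ABUTTING branch (total estrangement
  of the target, `branch_eq_of_hosts_eq`);
* `edgeMap_eq_of_compatV_thm37` — hence the same image of every edge having an abutting branch, i.e.
  (`exists_branch_abuts_of_prop36`: connected with a vertex) of EVERY edge: `base_maps_eq_of_compatV_thm37`;
* `Hom.IsIso.isLocallyOpen` — an isomorphism is locally open.

In particular the UNIQUENESS clause of the Cor. 3.11 step (C) (`CuspExtensionUnique`,
`TemperedSpecialFibreCusps.lean`) and of (S3′) (`SpecialFibreIsoOfDescendedIso`) are THEOREMS — print's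
ingredient (ii) enters through Thm. 3.7 (ii) (verticial subgroups are commensurably terminal) and total
estrangement.  Adapted from the two files named above (same lineage); no definition; nothing here takes
a side on [IUTchIII] Cor. 3.12.
-/

open CategoryTheory Topology

namespace Literature.AnabelianGeometry.SemiGraphs

namespace ProfiniteSemiGraph

universe u

variable {𝒢 ℋ : ProfiniteSemiGraph.{u}}

/-- An isomorphism of semi-graphs of anabelioids is locally open (its vertex and edge homomorphisms
are onto). [cite: MochizukiSemiAnbd2006, Def 2.2(ii) p.24] -/
theorem Hom.IsLocallyTrivial.isLocallyOpen {F : Hom 𝒢 ℋ} (h : F.IsLocallyTrivial) :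
    F.IsLocallyOpen := by
  refine ⟨fun v => ?_, fun e => ?_⟩
  · rw [MonoidHom.range_eq_top.mpr (h.1 v).2, Subgroup.coe_top]; exact isOpen_univ
  · rw [MonoidHom.range_eq_top.mpr (h.2 e).2, Subgroup.coe_top]; exact isOpen_univ

/-- **The host through `F b`** (Thm-3.7-hypotheses form of `exists_map_branchSubgroup_le_of_compat`):
for `φ` compatible at `v` with a locally open `F`, the image `φ(ψ(Π_b))` of the branch subgroup of a
branch `b` abutting to `v` is a NONTRIVIAL subgroup of the branch subgroup of `F b` in the host
`m · Ψ(Π_{F v}) · m⁻¹ = c · Ψ(Π_{F v}) · c⁻¹`. [cite: MochizukiSemiAnbd2006, Cor 3.9 pp.42-43] -/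
theorem exists_map_branchSubgroup_le_of_compat_thm37 (h37i : VerticialInjective.{u})
    (hℋ : ℋ.Thm37Hypotheses) (cℋ : TemperedPiChart ℋ) {P : Type u} [Group P] (F : Hom 𝒢 ℋ)
    (φ : P →* cℋ.G) (hF : F.IsLocallyOpen) {b : 𝒢.graph.Branch} {v : 𝒢.graph.Vertex}
    (hv : 𝒢.graph.abuts b = some v) (ψ : 𝒢.Gv v →* P)
    (Ψ : ℋ.Gv (F.base.vertexMap v) →ₜ* cℋ.G) (hΨ : IsVerticialHom cℋ (F.base.vertexMap v) Ψ)
    (c : cℋ.G) (hc : ∀ y, φ (ψ y) = c * Ψ (F.hV v y) * c⁻¹) :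
    ∃ m : cℋ.G,
      Ψ.toMonoidHom.range.map (MulAut.conj m).toMonoidHom =
          Ψ.toMonoidHom.range.map (MulAut.conj c).toMonoidHom ∧
        ((𝒢.branchSubgroup b v hv).map ψ).map φ ≤
          ((ℋ.branchSubgroup (F.base.branchMap b) (F.base.vertexMap v)
            (F.base.abuts_branchMap b v hv)).map Ψ.toMonoidHom).map (MulAut.conj m).toMonoidHom ∧
        ((𝒢.branchSubgroup b v hv).map ψ).map φ ≠ ⊥ := by
  obtain ⟨γ, hγ⟩ := F.exists_conj b v hv (F.base.edgeMap (𝒢.graph.edgeOf b)) rfl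
    (F.base.edgeOf_branchMap b)
  have hγz : ∀ z, γ * ℋ.brHomAt (F.base.branchMap b) (F.base.vertexMap v)
      (F.base.abuts_branchMap b v hv) _ (F.base.edgeOf_branchMap b) (F.hE _ z) * γ⁻¹ =
      F.hV v (𝒢.brHom b v hv z) := fun z => by
    have h := hγ z
    rw [Hom.hEAt_rfl] at h
    exact h
  refine ⟨c * Ψ γ, ?_, ?_, ?_⟩
  · apply le_antisymm
    · rintro _ ⟨_, ⟨y, rfl⟩, rfl⟩
      refine ⟨Ψ (γ * y * γ⁻¹), ⟨_, rfl⟩, ?_⟩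
      show c * Ψ (γ * y * γ⁻¹) * c⁻¹ = c * Ψ γ * Ψ y * (c * Ψ γ)⁻¹
      rw [map_mul Ψ, map_mul Ψ, map_inv Ψ]
      group
    · rintro _ ⟨_, ⟨y, rfl⟩, rfl⟩
      refine ⟨Ψ (γ⁻¹ * y * γ), ⟨_, rfl⟩, ?_⟩
      show c * Ψ γ * Ψ (γ⁻¹ * y * γ) * (c * Ψ γ)⁻¹ = c * Ψ y * c⁻¹
      rw [map_mul Ψ, map_mul Ψ, map_inv Ψ]
      group
  · rintro _ ⟨_, ⟨_, ⟨z, rfl⟩, rfl⟩, rfl⟩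
    refine ⟨Ψ (ℋ.brHomAt (F.base.branchMap b) (F.base.vertexMap v) (F.base.abuts_branchMap b v hv)
        _ (F.base.edgeOf_branchMap b) (F.hE _ z)), ⟨_, brHomAt_mem_branchSubgroup _ _ _, rfl⟩, ?_⟩
    show c * Ψ γ * Ψ (ℋ.brHomAt (F.base.branchMap b) (F.base.vertexMap v)
        (F.base.abuts_branchMap b v hv) _ (F.base.edgeOf_branchMap b) (F.hE _ z)) * (c * Ψ γ)⁻¹ =
        φ (ψ (𝒢.brHom b v hv z))
    rw [hc, ← hγz z, map_mul Ψ, map_mul Ψ, map_inv Ψ]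
    group
  · -- nontriviality: `F` is locally open and `Π_{F e}` is infinite
    intro h0
    have hopen := hF.2 (𝒢.graph.edgeOf b)
    have key : ∀ (f : ℋ.graph.Edge) (qq : ℋ.graph.edgeOf (F.base.branchMap b) = f)
        (η : 𝒢.Ge (𝒢.graph.edgeOf b) →ₜ* ℋ.Ge f), IsOpen (η.toMonoidHom.range : Set (ℋ.Ge f)) →
        (∀ z, φ (ψ (𝒢.brHom b v hv z)) =
          (c * Ψ γ) * Ψ (ℋ.brHomAt (F.base.branchMap b) (F.base.vertexMap v)
            (F.base.abuts_branchMap b v hv) f qq (η z)) * (c * Ψ γ)⁻¹) → False := by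
      intro f qq η hη hφ
      subst qq
      apply ne_bot_of_isOpen_ge hℋ.toProp36Hypotheses (F.base.abuts_branchMap b v hv) hη
      rw [eq_bot_iff]
      rintro _ ⟨z, rfl⟩
      have hz : φ (ψ (𝒢.brHom b v hv z)) ∈ ((𝒢.branchSubgroup b v hv).map ψ).map φ :=
        ⟨_, ⟨_, ⟨z, rfl⟩, rfl⟩, rfl⟩
      rw [h0, Subgroup.mem_bot, hφ z] at hz
      have h1 : Ψ (ℋ.brHomAt (F.base.branchMap b) (F.base.vertexMap v)
          (F.base.abuts_branchMap b v hv) _ rfl (η z)) = 1 := by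
        have := hz; rw [mul_inv_eq_one, mul_eq_left] at this; exact this
      have h2 := (h37i ℋ hℋ cℋ _).2 Ψ hΨ (by rw [h1, map_one] : Ψ _ = Ψ 1)
      exact brHomAt_injective hℋ.toProp36Hypotheses.isOfInjectiveType
        (F.base.abuts_branchMap b v hv) rfl
        (by rw [h2, map_one] : ℋ.brHomAt _ _ _ _ rfl (η z) = ℋ.brHomAt _ _ _ _ rfl 1)
    refine key _ (F.base.edgeOf_branchMap b) (F.hE _) hopen fun z => ?_
    rw [hc, ← hγz z, map_mul Ψ, map_mul Ψ, map_inv Ψ]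
    group

/-- **The host of `φ(ψ(Π_v))` is `c · Ψ(Π_{F v}) · c⁻¹`, with finite index** (Thm-3.7-hypotheses form of
`relIndex_map_range_ne_zero_of_compat`). [cite: MochizukiSemiAnbd2006, Cor 3.9 pp.42-43] -/
theorem relIndex_map_range_ne_zero_of_compat_thm37 (h37i : VerticialInjective.{u})
    (hℋ : ℋ.Thm37Hypotheses) (cℋ : TemperedPiChart ℋ) {P : Type u} [Group P] (F : Hom 𝒢 ℋ)
    (φ : P →* cℋ.G) (hF : F.IsLocallyOpen) (v : 𝒢.graph.Vertex) (ψ : 𝒢.Gv v →* P)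
    (Ψ : ℋ.Gv (F.base.vertexMap v) →ₜ* cℋ.G) (hΨ : IsVerticialHom cℋ (F.base.vertexMap v) Ψ)
    (c : cℋ.G) (hc : ∀ y, φ (ψ y) = c * Ψ (F.hV v y) * c⁻¹) :
    (ψ.range.map φ).relIndex (Ψ.toMonoidHom.range.map (MulAut.conj c).toMonoidHom) ≠ 0 := by
  let j : ℋ.Gv (F.base.vertexMap v) →* cℋ.G := (MulAut.conj c).toMonoidHom.comp Ψ.toMonoidHom
  have hj : Function.Injective j := fun a₁ a₂ h =>
    (h37i ℋ hℋ cℋ _).2 Ψ hΨ ((MulAut.conj c).injective h)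
  let U : Subgroup (ℋ.Gv (F.base.vertexMap v)) := (F.hV v).toMonoidHom.range
  have hS : ψ.range.map φ = U.map j := by
    ext y
    constructor
    · rintro ⟨_, ⟨x, rfl⟩, rfl⟩
      exact ⟨F.hV v x, ⟨x, rfl⟩, (hc x).symm⟩
    · rintro ⟨_, ⟨x, rfl⟩, rfl⟩
      exact ⟨ψ x, ⟨x, rfl⟩, hc x⟩
  have hW : Ψ.toMonoidHom.range.map (MulAut.conj c).toMonoidHom =
      (⊤ : Subgroup (ℋ.Gv (F.base.vertexMap v))).map j := by
    rw [MonoidHom.range_eq_map, Subgroup.map_map]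
  have hU : U.index ≠ 0 := by
    haveI := Subgroup.quotient_finite_of_isOpen U (hF.1 v)
    exact Subgroup.index_ne_zero_of_finite
  rw [hS, hW, Subgroup.relIndex_map_map_of_injective _ _ hj, Subgroup.relIndex_top_right]
  exact hU

/-- **Uniqueness of the vertex map, for semi-graphs of anabelioids satisfying the hypotheses of
Thm. 3.7** (the proof of abc-iut-L3-t2's `compatible_vertexMap_eq`, which reads its `Cor39Hypotheses`
only through Thm. 3.7): two locally open `F, F' : G → H` compatible with the same `φ` on verticial
homomorphisms agree on vertices. [cite: MochizukiSemiAnbd2006, Cor 3.9 p.43] -/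
theorem vertexMap_eq_of_compatV_thm37 (h𝒢 : 𝒢.Thm37Hypotheses) (hℋ : ℋ.Thm37Hypotheses)
    (c𝒢 : TemperedPiChart 𝒢) (cℋ : TemperedPiChart ℋ) {F F' : Hom 𝒢 ℋ} {φ : c𝒢.G →ₜ* cℋ.G}
    (hF : F.IsLocallyOpen) (hV : F.CompatV c𝒢 cℋ φ) (hV' : F'.CompatV c𝒢 cℋ φ) :
    F.base.vertexMap = F'.base.vertexMap := by
  have h37i := verticialInjective_holds.{u}
  have h37ii := verticialDistinct_holds.{u}
  funext v
  obtain ⟨⟨_, ψ, ⟨eψ⟩, rfl⟩, -⟩ := h37i 𝒢 h𝒢 c𝒢 v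
  obtain ⟨⟨_, ψ₁, ⟨e₁⟩, rfl⟩, hinj₁⟩ := h37i ℋ hℋ cℋ (F.base.vertexMap v)
  obtain ⟨⟨_, ψ₂, ⟨e₂⟩, rfl⟩, -⟩ := h37i ℋ hℋ cℋ (F'.base.vertexMap v)
  obtain ⟨g₁, hg₁⟩ := hV v ψ ψ₁ ⟨eψ⟩ ⟨e₁⟩
  obtain ⟨g₂, hg₂⟩ := hV' v ψ ψ₂ ⟨eψ⟩ ⟨e₂⟩
  let S : Subgroup cℋ.G := ψ.toMonoidHom.range.map φ.toMonoidHom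
  let W₁ : Subgroup cℋ.G := ψ₁.toMonoidHom.range.map (MulAut.conj g₁).toMonoidHom
  let W₂ : Subgroup cℋ.G := ψ₂.toMonoidHom.range.map (MulAut.conj g₂).toMonoidHom
  have hW₁ : W₁ ∈ verticialSubgroups cℋ (F.base.vertexMap v) :=
    conj_mem_verticialSubgroups cℋ ⟨ψ₁, ⟨e₁⟩, rfl⟩ g₁
  have hW₂ : W₂ ∈ verticialSubgroups cℋ (F'.base.vertexMap v) :=
    conj_mem_verticialSubgroups cℋ ⟨ψ₂, ⟨e₂⟩, rfl⟩ g₂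
  have hSW₂ : S ≤ W₂ := by
    rintro _ ⟨_, ⟨x, rfl⟩, rfl⟩
    refine ⟨ψ₂ (F'.hV v x), ⟨F'.hV v x, rfl⟩, ?_⟩
    change g₂ * ψ₂ (F'.hV v x) * g₂⁻¹ = φ (ψ x)
    exact (hg₂ x).symm
  let j : ℋ.Gv (F.base.vertexMap v) →* cℋ.G :=
    (MulAut.conj g₁).toMonoidHom.comp ψ₁.toMonoidHom
  have hj : Function.Injective j := fun a b h =>
    hinj₁ ψ₁ ⟨e₁⟩ ((MulAut.conj g₁).injective h)
  let U : Subgroup (ℋ.Gv (F.base.vertexMap v)) := (F.hV v).toMonoidHom.range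
  have hS : S = U.map j := by
    ext y
    constructor
    · rintro ⟨_, ⟨x, rfl⟩, rfl⟩
      exact ⟨F.hV v x, ⟨x, rfl⟩, (hg₁ x).symm⟩
    · rintro ⟨_, ⟨x, rfl⟩, rfl⟩
      exact ⟨ψ x, ⟨x, rfl⟩, hg₁ x⟩
  have hW₁j : W₁ = (⊤ : Subgroup (ℋ.Gv (F.base.vertexMap v))).map j := by
    change (Subgroup.map _ _) = _
    rw [MonoidHom.range_eq_map, Subgroup.map_map]
  have hU : U.index ≠ 0 := by
    haveI := Subgroup.quotient_finite_of_isOpen U (hF.1 v)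
    exact Subgroup.index_ne_zero_of_finite
  have hSW₁ : S.relIndex W₁ ≠ 0 := by
    rw [hS, hW₁j, Subgroup.relIndex_map_map_of_injective _ _ hj, Subgroup.relIndex_top_right]
    exact hU
  have hW₂W₁ : W₂.relIndex W₁ ≠ 0 := fun h0 => hSW₁ (Subgroup.relIndex_eq_zero_of_le_left hSW₂ h0)
  by_contra hne
  exact hW₂W₁ ((h37ii ℋ hℋ cℋ).1 _ _ W₁ W₂ hW₁ hW₂ hne)

/-- **Uniqueness of the image of an ABUTTING branch, for semi-graphs of anabelioids satisfying the
hypotheses of Thm. 3.7** (the proof of `compatible_branchMap_eq` at one branch): two locally open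
`F, F'` compatible with the same `φ` on verticial homomorphisms send a branch `b` abutting to a vertex
to the same branch — one host (Thm. 3.7 (ii)) and, by total estrangement of `H`, one branch of it
containing the nontrivial `φ(ψ(Π_b))`; this covers the abutting branch of a CUSP (Cor. 3.11 proof
p. 47, "extends uniquely"). [cite: MochizukiSemiAnbd2006, Cor 3.11 p.47] -/
theorem branchMap_eq_of_compatV_thm37 (h𝒢 : 𝒢.Thm37Hypotheses) (hℋ : ℋ.Thm37Hypotheses)
    (c𝒢 : TemperedPiChart 𝒢) (cℋ : TemperedPiChart ℋ) {F F' : Hom 𝒢 ℋ} {φ : c𝒢.G →ₜ* cℋ.G}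
    (hF : F.IsLocallyOpen) (hF' : F'.IsLocallyOpen) (hV : F.CompatV c𝒢 cℋ φ)
    (hV' : F'.CompatV c𝒢 cℋ φ) {b : 𝒢.graph.Branch} {v : 𝒢.graph.Vertex}
    (hv : 𝒢.graph.abuts b = some v) : F.base.branchMap b = F'.base.branchMap b := by
  classical
  have h37i := verticialInjective_holds.{u}
  have h37ii := verticialDistinct_holds.{u}
  obtain ⟨⟨_, ψ, ⟨eψ⟩, rfl⟩, -⟩ := h37i 𝒢 h𝒢 c𝒢 v
  choose Ψ hΨ using exists_isVerticialHom_of_thm37i h37i hℋ cℋ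
  obtain ⟨c₁, hc₁⟩ := hV v ψ (Ψ _) ⟨eψ⟩ (hΨ _)
  obtain ⟨c₂, hc₂⟩ := hV' v ψ (Ψ _) ⟨eψ⟩ (hΨ _)
  obtain ⟨m₁, hm₁, hle₁, hne₁⟩ := exists_map_branchSubgroup_le_of_compat_thm37 h37i hℋ cℋ F
    φ.toMonoidHom hF hv ψ.toMonoidHom (Ψ _) (hΨ _) c₁ hc₁
  obtain ⟨m₂, hm₂, hle₂, -⟩ := exists_map_branchSubgroup_le_of_compat_thm37 h37i hℋ cℋ F'
    φ.toMonoidHom hF' hv ψ.toMonoidHom (Ψ _) (hΨ _) c₂ hc₂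
  have hW₁ : (Ψ (F.base.vertexMap v)).toMonoidHom.range.map (MulAut.conj m₁).toMonoidHom ∈
      verticialSubgroups cℋ (F.base.vertexMap v) :=
    conj_mem_verticialSubgroups cℋ (range_mem_verticialSubgroups cℋ (Ψ _) (hΨ _)) m₁
  have hW₂ : (Ψ (F'.base.vertexMap v)).toMonoidHom.range.map (MulAut.conj m₂).toMonoidHom ∈
      verticialSubgroups cℋ (F'.base.vertexMap v) :=
    conj_mem_verticialSubgroups cℋ (range_mem_verticialSubgroups cℋ (Ψ _) (hΨ _)) m₂
  have hS₁ : (ψ.toMonoidHom.range.map φ.toMonoidHom).relIndex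
      ((Ψ (F.base.vertexMap v)).toMonoidHom.range.map (MulAut.conj m₁).toMonoidHom) ≠ 0 := by
    rw [hm₁]
    exact relIndex_map_range_ne_zero_of_compat_thm37 h37i hℋ cℋ F φ.toMonoidHom hF v ψ.toMonoidHom
      (Ψ _) (hΨ _) c₁ hc₁
  have hS₂ : ψ.toMonoidHom.range.map φ.toMonoidHom ≤
      (Ψ (F'.base.vertexMap v)).toMonoidHom.range.map (MulAut.conj m₂).toMonoidHom := by
    rw [hm₂]
    rintro _ ⟨_, ⟨x, rfl⟩, rfl⟩
    exact ⟨Ψ _ (F'.hV v x), ⟨F'.hV v x, rfl⟩, (hc₂ x).symm⟩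
  have hW₂W₁ : ((Ψ (F'.base.vertexMap v)).toMonoidHom.range.map (MulAut.conj m₂).toMonoidHom).relIndex
      ((Ψ (F.base.vertexMap v)).toMonoidHom.range.map (MulAut.conj m₁).toMonoidHom) ≠ 0 :=
    fun h0 => hS₁ (Subgroup.relIndex_eq_zero_of_le_left hS₂ h0)
  have hW := eq_of_relIndex_ne_zero_of_mem_verticialSubgroups h37ii hℋ cℋ hW₁ hW₂ hW₂W₁
  exact branch_eq_of_hosts_eq h37ii h37i hℋ cℋ Ψ hΨ hne₁ (F.base.abuts_branchMap b v hv)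
    (F'.base.abuts_branchMap b v hv) m₁ m₂ hle₁ hle₂ hW

/-- The image of an edge having an abutting branch is determined. [cite: MochizukiSemiAnbd2006, Cor 3.11 p.47] -/
theorem edgeMap_eq_of_compatV_thm37 (h𝒢 : 𝒢.Thm37Hypotheses) (hℋ : ℋ.Thm37Hypotheses)
    (c𝒢 : TemperedPiChart 𝒢) (cℋ : TemperedPiChart ℋ) {F F' : Hom 𝒢 ℋ} {φ : c𝒢.G →ₜ* cℋ.G}
    (hF : F.IsLocallyOpen) (hF' : F'.IsLocallyOpen) (hV : F.CompatV c𝒢 cℋ φ)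
    (hV' : F'.CompatV c𝒢 cℋ φ) {e : 𝒢.graph.Edge} {b : 𝒢.graph.Branch} {v : 𝒢.graph.Vertex}
    (he : 𝒢.graph.edgeOf b = e) (hv : 𝒢.graph.abuts b = some v) :
    F.base.edgeMap e = F'.base.edgeMap e := by
  subst he
  rw [← F.base.edgeOf_branchMap, ← F'.base.edgeOf_branchMap,
    branchMap_eq_of_compatV_thm37 h𝒢 hℋ c𝒢 cℋ hF hF' hV hV' hv]

/-- In a connected semi-graph with a vertex every edge has a branch abutting to a vertex (a closed
edge: both; an open edge: exactly one — the maximal subgraph is a cusp omission, §1 p. 13).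
[cite: MochizukiSemiAnbd2006, §1 p.13] -/
theorem exists_branch_abuts_of_prop36 (h : 𝒢.Prop36Hypotheses) (e : 𝒢.graph.Edge) :
    ∃ (b : 𝒢.graph.Branch) (v : 𝒢.graph.Vertex), 𝒢.graph.edgeOf b = e ∧ 𝒢.graph.abuts b = some v := by
  by_cases he : e ∈ 𝒢.graph.maximalSubgraph.edges
  · obtain ⟨b, -, -, hb, -, -⟩ := 𝒢.graph.two_branches e
    obtain ⟨v, hv⟩ := Option.isSome_iff_exists.mp
      (SemiGraph.isSome_abuts_of_mem_maximalSubgraph (G := 𝒢.graph) (b := b) (hb ▸ he))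
    exact ⟨b, v, hb, hv⟩
  · obtain ⟨b, hb, hs, -⟩ :=
      (SemiGraph.maximalSubgraph_isCuspOmission_of_isConnected h.isConnected h.hasVertex).existsUnique_abuts
        e he
    obtain ⟨v, hv⟩ := Option.isSome_iff_exists.mp hs
    exact ⟨b, v, hb, hv⟩

/-- **Cor. 3.9 (b) uniqueness of vertex and edge maps, for semi-graphs of anabelioids satisfying the
hypotheses of Thm. 3.7** (cusps allowed): two locally open `F, F' : G → H` compatible with the same
`φ` on verticial homomorphisms have the same vertex map and the same edge map — in particular the
"extends uniquely" of Cor. 3.11's step (C) and the uniqueness clause of (S3′) hold outright.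
[cite: MochizukiSemiAnbd2006, Cor 3.11 p.47] -/
theorem base_maps_eq_of_compatV_thm37 (h𝒢 : 𝒢.Thm37Hypotheses) (hℋ : ℋ.Thm37Hypotheses)
    (c𝒢 : TemperedPiChart 𝒢) (cℋ : TemperedPiChart ℋ) {F F' : Hom 𝒢 ℋ} {φ : c𝒢.G →ₜ* cℋ.G}
    (hF : F.IsLocallyOpen) (hF' : F'.IsLocallyOpen) (hV : F.CompatV c𝒢 cℋ φ)
    (hV' : F'.CompatV c𝒢 cℋ φ) :
    F.base.vertexMap = F'.base.vertexMap ∧ F.base.edgeMap = F'.base.edgeMap := by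
  refine ⟨vertexMap_eq_of_compatV_thm37 h𝒢 hℋ c𝒢 cℋ hF hV hV', funext fun e => ?_⟩
  obtain ⟨b, v, he, hv⟩ := exists_branch_abuts_of_prop36 h𝒢.toProp36Hypotheses e
  exact edgeMap_eq_of_compatV_thm37 h𝒢 hℋ c𝒢 cℋ hF hF' hV hV' he hv

end ProfiniteSemiGraph

end Literature.AnabelianGeometry.SemiGraphs
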